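import Summits.KontsevichZagierPeriods.Zeta5Search.Certificates.RayKernelMultiplier
import Summits.KontsevichZagierPeriods.Zeta5Search.Denom.DualSeriesBrickOrd
import HarnessLib

/-!
# ζ(5) search — certificates: the GENERIC brick divisibility certificate for the kernel multiplier (TYPER g16)

HONEST FRAMING: systematic search; no irrationality claim unless certified.  `p`-adic bookkeeping of explicit rationals;
nothing here is a statement about `ζ(5)`.

OUR work (Summit side; typer seat, generation 16).  Sequel of `Certificates/RayKernelMultiplier`.  The Φ/(8.11) port of
fam-denom 62 — `Denom.DualSeriesBrickOrd.padicOrdGe_sharp_ints`, GENERIC in the dual parameters `b`: for a prime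
`5 < p ≤ b₀ < p²` and any `ν ≤ min_{i ≤ b₀} ν(b; i, p)` (Zudilin 2004 (8.9)–(8.11) for the Brown–Zudilin pair grouping (35)),
`ord_p` of `d·N♯U`, `d³·N♯W`, `d⁶·N♯V` is `≥ ν` — is CONSUMED BY NAME here (no fork) and turned into the input format of
`RayKernel.atlas_ints`:

* **`brick_cert`** — for an admissible pair `(b, b′)` with the same `b₀`, `ν ≤ min_i ν(b;i,p)`, `ν′ ≤ min_i ν(b′;i,p)` and
  `k ≤ ν + ν′`: `p^k ∣ wedgeNumZ b b′` and `p^k ∣ qNumZ b b′`.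

The brick exponents `ν, ν′` of a given ray on a given `θ`-cell are certified per ray by fam-denom's ONE checker
`Denom.DigitCert.Cell.check` (lead ruling R-D0); this file is ray-independent.
-/

noncomputable section

open Finset

namespace Summit.KontsevichZagierPeriods.Zeta5Search.RayKernel

open Summit.KontsevichZagierPeriods.Zeta5Search.DualSeries
open Summit.KontsevichZagierPeriods.Zeta5Search.DualSeriesDenominators
open Summit.KontsevichZagierPeriods.Zeta5Search.WedgeDictionary
open Summit.KontsevichZagierPeriods.Zeta5Search.Denom.DualSeriesBrickOrd (nuPair padicOrdGe_sharp_ints)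
open Literature.NumberTheory.Transcendental (PadicOrdGe)

variable {b b' : ℕ → ℤ} {p : ℕ} [hp : Fact p.Prime]

omit hp in
/-- `ord_p(−q) ≥ v` from `ord_p(q) ≥ v`. -/
private theorem padicOrdGe_neg' {v : ℤ} {q : ℚ} (h : PadicOrdGe p v q) : PadicOrdGe p v (-q) := by
  rcases h with h | h
  · exact Or.inl (by rw [h, neg_zero])
  · exact Or.inr (by rwa [padicValRat.neg])

/-- `ord_p(q − r) ≥ v` from `ord_p(q), ord_p(r) ≥ v`. -/
private theorem padicOrdGe_sub' {v : ℤ} {q r : ℚ} (hq : PadicOrdGe p v q) (hr : PadicOrdGe p v r) :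
    PadicOrdGe p v (q - r) := by
  rw [sub_eq_add_neg]; exact hq.add (padicOrdGe_neg' hr)

/-- An integer whose rational image has `ord_p ≥ ν ≥ k` is divisible by `p^k`. -/
private theorem int_dvd_of_padicOrdGe' {ν : ℤ} {z : ℤ} (h : PadicOrdGe p ν (z : ℚ)) {k : ℕ} (hk : (k : ℤ) ≤ ν) :
    (p : ℤ) ^ k ∣ z := by
  rw [padicValInt_dvd_iff]
  by_cases hz : z = 0
  · exact Or.inl hz
  · right
    rcases h with h | h
    · exact absurd (by exact_mod_cast h) hz
    · rw [padicValRat.of_int] at h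
      exact_mod_cast hk.trans h

/-- The three integers of the kernel at `b` have `ord_p ≥ ν` (fam-denom 62 `padicOrdGe_sharp_ints`, in the `zU/zW/zV` names). -/
theorem brick_ords (hb : SharpAdmissible b) (hp5 : 5 < p) (hpb : p ≤ bn b 0) (hp2 : bn b 0 < p ^ 2)
    {ν : ℤ} (hν : ∀ i, i ≤ bn b 0 → ν ≤ nuPair b i p) :
    PadicOrdGe p ν (zU b) ∧ PadicOrdGe p ν (zW b) ∧ PadicOrdGe p ν (zV b) :=
  padicOrdGe_sharp_ints hb.1 hb.2.1 hb.2.2 hp5 hpb hp2 hν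

/-- **The brick certificate.**  For an admissible pair `(b, b′)` with `b′₀ = b₀`, a prime `5 < p ≤ b₀ < p²`, brick exponents
`ν ≤ min_{i ≤ b₀} ν(b;i,p)` and `ν′ ≤ min_{i ≤ b₀} ν(b′;i,p)`, and every `k ≤ ν + ν′`:
`p^k ∣ wedgeNumZ b b′` and `p^k ∣ qNumZ b b′`. -/
theorem brick_cert (hb : SharpAdmissible b) (hb' : SharpAdmissible b') (h0 : bn b' 0 = bn b 0)
    (hp5 : 5 < p) (hpb : p ≤ bn b 0) (hp2 : bn b 0 < p ^ 2)
    {ν ν' : ℤ} (hν : ∀ i, i ≤ bn b 0 → ν ≤ nuPair b i p) (hν' : ∀ i, i ≤ bn b' 0 → ν' ≤ nuPair b' i p)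
    {k : ℕ} (hk : (k : ℤ) ≤ ν + ν') :
    (p : ℤ) ^ k ∣ wedgeNumZ b b' ∧ (p : ℤ) ^ k ∣ qNumZ b b' := by
  obtain ⟨hU, hW, hV⟩ := brick_ords hb hp5 hpb hp2 hν
  obtain ⟨hU', hW', hV'⟩ := brick_ords hb' hp5 (by rw [h0]; exact hpb) (by rw [h0]; exact hp2) hν'
  have hd : PadicOrdGe p 0 (dOf0 b ^ 5) := by
    have := (PadicOrdGe.of_nat (p := p) (Nat.lcmUpto (bn b 0))).pow 5
    simpa [dOf0] using this
  constructor
  · have h1 : PadicOrdGe p (ν' + ν) (zW b' * zV b) := hW'.mul hV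
    have h2 : PadicOrdGe p (ν + ν') (zW b * zV b') := hW.mul hV'
    have h12 : PadicOrdGe p (ν + ν') (wedgeNum b b') := by
      unfold wedgeNum
      exact padicOrdGe_sub' (h1.mono (by omega)) h2
    rw [← wedgeNumZ_cast hb hb'] at h12
    exact int_dvd_of_padicOrdGe' h12 hk
  · have h1 : PadicOrdGe p (ν + ν') (zU b * zW b') := hU.mul hW'
    have h2 : PadicOrdGe p (ν' + ν) (zU b' * zW b) := hU'.mul hW
    have h12 : PadicOrdGe p (0 + (ν + ν')) (qNum b b') := by
      unfold qNum
      exact hd.mul (padicOrdGe_sub' h1 (h2.mono (by omega)))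
    rw [zero_add, ← qNumZ_cast hb hb'] at h12
    exact int_dvd_of_padicOrdGe' h12 hk

end Summit.KontsevichZagierPeriods.Zeta5Search.RayKernel
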